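import Mathlib
import Literature.AlgebraicGeometry.Resolution.FormalCoordinateChange
import Literature.AlgebraicGeometry.Resolution.FormalInverseFunction
import Literature.AlgebraicGeometry.Resolution.CobordantArcLemma

/-!
# Shears `y ↦ y + ψ(x)` of `k[[x, y]]` and the graph form of a `y`-regular smooth germ

Folklore infrastructure about `MvPowerSeries (Fin 2) k` (`x = X 0`, `y = X 1`, `k` a field),
written for the plane case of the local weighted resolution game (crux `LocalWeightedDrop`,
stmt-ResolutionOfSingularities-8899: the step "approximate `d`-th powers to all orders ⇒ exact
`d`-th power", file `Summits/…/Theorems/WeightedInvariantLocalWeightedDropApproxPowerExact.lean`),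
in the vocabulary of `Mathlib.RingTheory.MvPowerSeries.Substitution`:

* SERIES IN `x` ONLY: "`g` has no monomial involving `y`" is the coefficient condition
  `∀ e, e 1 ≠ 0 → coeff e g = 0`; such `g` are fixed by every substitution fixing `x`
  (`subst_eq_self_of_noY`).
* KILLING `y`: a family `a = (x, 0)` (hypotheses `a 0 = X 0`, `a 1 = 0`); `coeff_kill` (the
  monomials free of `y` survive, the others die), so `subst a g` is in `x` only (`noY_kill`) and
  a series killed by `y ↦ 0` is divisible by `y` (`X_dvd_of_kill_eq_zero`).
* SHEARS: the families `(x, y + ψ) = ![X 0, X 1 + ψ]`; for `ψ` in `x` only they compose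
  additively (`shear_shear`, `shear_neg_shear`), do not change the `y`-linear coefficient
  (`coeff_single_one_shear`), and `(x, 0) ∘ (x, y + ψ) = (x, ψ)` (`kill_shear`).
* GRAPH FORM (`graph`, the order-one formal implicit function theorem): if `L(0) = 0` and
  `∂L/∂y(0) ≠ 0` then `T_ψ L = y · W` for the shear `T_ψ` by some `ψ` in `x` only with
  `ψ(0) = 0`, and `W(0) ≠ 0` (so `L = unit · (y - ψ(x))`).  Proof: `Θ = (x, L)` is a formal
  coordinate change; its inverse `Ξ = (x, η)` (`FormalCoordChange.exists_comp_inverse`) has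
  `L(x, η) = y`, so killing `y` gives `L(x, ψ) = 0` for `ψ = η(x, 0)`; hence
  `(T_ψ L)(x, 0) = L(x, ψ) = 0` and `y ∣ T_ψ L`.
* ORDERS: substitutions by constant-free families do not lower the order
  (`order_le_order_subst'`), `le_order_sub`, `order_pow_eq`, `coeff_eq_zero_of_le_order_pow`.

No definitions.  Deliberately NOT here: more than two variables, and the higher-order implicit
function theorem (only the graph form of a smooth germ is needed).
-/

open MvPowerSeries

namespace Literature.AlgebraicGeometry.Resolution.FormalShear

variable {k : Type*} [Field k]

/-! ### 1. Series in `x` only -/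

/-- Series without `y`-monomials are stable under subtraction. [folklore] -/
theorem noY_sub {a b : MvPowerSeries (Fin 2) k}
    (ha : ∀ e : Fin 2 →₀ ℕ, e 1 ≠ 0 → coeff e a = 0)
    (hb : ∀ e : Fin 2 →₀ ℕ, e 1 ≠ 0 → coeff e b = 0) :
    ∀ e : Fin 2 →₀ ℕ, e 1 ≠ 0 → coeff e (a - b) = 0 :=
  fun e he => by rw [map_sub, ha e he, hb e he, sub_zero]

/-- Series without `y`-monomials are stable under negation. [folklore] -/
theorem noY_neg {a : MvPowerSeries (Fin 2) k}
    (ha : ∀ e : Fin 2 →₀ ℕ, e 1 ≠ 0 → coeff e a = 0) :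
    ∀ e : Fin 2 →₀ ℕ, e 1 ≠ 0 → coeff e (-a) = 0 :=
  fun e he => by rw [map_neg, ha e he, neg_zero]

/-- A series without `y`-monomials has no `y`-linear term. [folklore] -/
theorem coeff_single_one_of_noY {g : MvPowerSeries (Fin 2) k}
    (hg : ∀ e : Fin 2 →₀ ℕ, e 1 ≠ 0 → coeff e g = 0) :
    coeff (Finsupp.single 1 1) g = 0 :=
  hg _ (by simp)

/-- A substitution fixing `x` fixes every series without `y`-monomials. [folklore] -/
theorem subst_eq_self_of_noY {a : Fin 2 → MvPowerSeries (Fin 2) k} (ha : HasSubst a)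
    (ha0 : a 0 = X 0) {g : MvPowerSeries (Fin 2) k}
    (hg : ∀ e : Fin 2 →₀ ℕ, e 1 ≠ 0 → coeff e g = 0) : subst a g = g := by
  -- adapted from `TameSliceKappa.subst_eq_self_of_support` (Summits side)
  classical
  have hz : ∀ d : Fin 2 →₀ ℕ, coeff d g ≠ 0 → d = Finsupp.single 0 (d 0) := by
    intro d hd
    ext i
    fin_cases i
    · simp
    · suffices h1 : d 1 = 0 by simpa using h1
      by_contra h
      exact hd (hg d h)
  have hprod : ∀ d : Fin 2 →₀ ℕ, coeff d g ≠ 0 →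
      (d.prod fun s m => a s ^ m) = X 0 ^ (d 0) := by
    intro d hd
    conv_lhs => rw [hz d hd]
    rw [Finsupp.prod_single_index (h := fun s m => a s ^ m) (pow_zero _), ha0]
  ext e
  rw [coeff_subst ha, finsum_eq_single _ e]
  · by_cases he : coeff e g = 0
    · rw [he, zero_smul]
    · rw [hprod e he, coeff_X_pow, if_pos (hz e he), smul_eq_mul, mul_one]
  · intro d hde
    by_cases hd : coeff d g = 0
    · rw [hd, zero_smul]
    · rw [hprod d hd, coeff_X_pow, if_neg, smul_zero]
      intro h
      exact hde ((hz d hd).trans h.symm)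

/-- A substitution by series without constant terms does not change the constant term.
[folklore] -/
theorem constantCoeff_subst_eq_of_constantCoeff_eq_zero {n : ℕ}
    (a : Fin n → MvPowerSeries (Fin 2) k) (ha : ∀ i, constantCoeff (a i) = 0)
    (u : MvPowerSeries (Fin n) k) : constantCoeff (subst a u) = constantCoeff u := by
  have has := hasSubst_of_constantCoeff_zero ha
  have hsplit : u = C (constantCoeff u) + (u - C (constantCoeff u)) := by ring
  conv_lhs => rw [hsplit]
  rw [subst_add has, subst_C, map_add, constantCoeff_C,
    constantCoeff_subst_eq_zero has ha (by simp), add_zero]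

/-- Substitutions by families with zero constant terms do not lower the order. [folklore] -/
theorem order_le_order_subst' (a : Fin 2 → MvPowerSeries (Fin 2) k)
    (ha : ∀ i, constantCoeff (a i) = 0) (g : MvPowerSeries (Fin 2) k) :
    g.order ≤ (subst a g).order := by
  have h1 : (1 : ℕ∞) ≤ ⨅ i, (a i).order :=
    le_iInf fun i => one_le_order_iff_constCoeff_eq_zero.mpr (ha i)
  calc g.order = 1 * g.order := (one_mul _).symm
    _ ≤ (⨅ i, (a i).order) * g.order := mul_le_mul' h1 le_rfl
    _ ≤ _ := le_order_subst (hasSubst_of_constantCoeff_zero ha) g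

/-! ### 2. Killing `y`: families `a = (x, 0)` -/

/-- The components of a kill-`y` family have zero constant terms. [folklore] -/
theorem constantCoeff_kill {a : Fin 2 → MvPowerSeries (Fin 2) k} (ha0 : a 0 = X 0)
    (ha1 : a 1 = 0) : ∀ i, constantCoeff (a i) = 0 := by
  intro i
  fin_cases i
  · show constantCoeff (a 0) = 0
    rw [ha0, constantCoeff_X]
  · show constantCoeff (a 1) = 0
    rw [ha1, map_zero]

/-- COEFFICIENTS AFTER KILLING `y`: the monomials free of `y` survive, the others die.
[folklore] -/
theorem coeff_kill {a : Fin 2 → MvPowerSeries (Fin 2) k} (ha0 : a 0 = X 0) (ha1 : a 1 = 0)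
    (g : MvPowerSeries (Fin 2) k) (e : Fin 2 →₀ ℕ) :
    coeff e (subst a g) = if e 1 = 0 then coeff e g else 0 := by
  classical
  rw [coeff_subst (hasSubst_of_constantCoeff_zero (constantCoeff_kill ha0 ha1))]
  have hprod : ∀ d : Fin 2 →₀ ℕ,
      (d.prod fun s m => a s ^ m) = X 0 ^ (d 0) * (0 : MvPowerSeries (Fin 2) k) ^ (d 1) := by
    intro d
    rw [Finsupp.prod_fintype _ _ (fun i => pow_zero _), Fin.prod_univ_two, ha0, ha1]
  have hsingle : ∀ d : Fin 2 →₀ ℕ, d 1 = 0 → d = Finsupp.single 0 (d 0) := by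
    intro d hd
    ext i
    fin_cases i
    · simp
    · simpa using hd
  simp_rw [hprod]
  by_cases he : e 1 = 0
  · rw [if_pos he, finsum_eq_single _ e]
    · rw [he, pow_zero, mul_one, coeff_X_pow, if_pos (hsingle e he), smul_eq_mul, mul_one]
    · intro d hd
      by_cases hd1 : d 1 = 0
      · rw [hd1, pow_zero, mul_one, coeff_X_pow, if_neg, smul_zero]
        intro h
        apply hd
        rw [hsingle d hd1, hsingle e he, h]
        simp
      · rw [zero_pow hd1, mul_zero, map_zero, smul_zero]
  · rw [if_neg he]
    apply finsum_eq_zero_of_forall_eq_zero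
    intro d
    by_cases hd1 : d 1 = 0
    · rw [hd1, pow_zero, mul_one, coeff_X_pow, if_neg, smul_zero]
      intro h
      apply he
      rw [h]
      simp
    · rw [zero_pow hd1, mul_zero, map_zero, smul_zero]

/-- Killing `y` produces a series without `y`-monomials. [folklore] -/
theorem noY_kill {a : Fin 2 → MvPowerSeries (Fin 2) k} (ha0 : a 0 = X 0) (ha1 : a 1 = 0)
    (g : MvPowerSeries (Fin 2) k) :
    ∀ e : Fin 2 →₀ ℕ, e 1 ≠ 0 → coeff e (subst a g) = 0 :=
  fun e he => by rw [coeff_kill ha0 ha1, if_neg he]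

/-- A series killed by `y ↦ 0` is divisible by `y`. [folklore] -/
theorem X_dvd_of_kill_eq_zero {a : Fin 2 → MvPowerSeries (Fin 2) k} (ha0 : a 0 = X 0)
    (ha1 : a 1 = 0) {M : MvPowerSeries (Fin 2) k} (hM : subst a M = 0) : X 1 ∣ M := by
  rw [X_dvd_iff]
  intro m hm
  have h := congrArg (coeff m) hM
  rwa [coeff_kill ha0 ha1, if_pos hm, map_zero] at h

/-! ### 3. The shears `T_ψ : (x, y) ↦ (x, y + ψ)` -/

/-- The shear family `(x, y + ψ)` at `1`. [folklore] -/
theorem shearFamily_apply_one (ψ : MvPowerSeries (Fin 2) k) : ![X 0, X 1 + ψ] 1 = X 1 + ψ :=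
  rfl

/-- The components of a shear have zero constant terms. [folklore] -/
theorem constantCoeff_shear {ψ : MvPowerSeries (Fin 2) k} (hψ : constantCoeff ψ = 0) :
    ∀ i, constantCoeff (![X 0, X 1 + ψ] i) = 0 := by
  intro i
  fin_cases i
  · exact constantCoeff_X 0
  · show constantCoeff (X 1 + ψ) = 0
    rw [map_add, constantCoeff_X, hψ, add_zero]

/-- A shear is substitutable. [folklore] -/
theorem hasSubst_shear {ψ : MvPowerSeries (Fin 2) k} (hψ : constantCoeff ψ = 0) :
    HasSubst ![X 0, X 1 + ψ] :=
  hasSubst_of_constantCoeff_zero (constantCoeff_shear hψ)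

/-- COMPOSITION OF SHEARS: `T_a (T_b g) = T_{a + b} g` for `b` in `x` only. [folklore] -/
theorem shear_shear {a b : MvPowerSeries (Fin 2) k}
    (hb : ∀ e : Fin 2 →₀ ℕ, e 1 ≠ 0 → coeff e b = 0) (ha0 : constantCoeff a = 0)
    (hb0 : constantCoeff b = 0) (g : MvPowerSeries (Fin 2) k) :
    subst ![X 0, X 1 + a] (subst ![X 0, X 1 + b] g) = subst ![X 0, X 1 + (a + b)] g := by
  rw [subst_comp_subst_apply (hasSubst_shear hb0) (hasSubst_shear ha0)]
  congr 1
  funext s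
  fin_cases s
  · show subst ![X 0, X 1 + a] (X 0) = X 0
    rw [subst_X (hasSubst_shear ha0)]
    rfl
  · show subst ![X 0, X 1 + a] (X 1 + b) = X 1 + (a + b)
    rw [subst_add (hasSubst_shear ha0), subst_X (hasSubst_shear ha0), shearFamily_apply_one,
      subst_eq_self_of_noY (hasSubst_shear ha0) rfl hb, add_assoc]

/-- The trivial shear is the identity. [folklore] -/
theorem shear_zero (g : MvPowerSeries (Fin 2) k) : subst ![X 0, X 1 + 0] g = g := by
  have h : ![X 0, X 1 + (0 : MvPowerSeries (Fin 2) k)] = X := by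
    funext s
    fin_cases s
    · rfl
    · show X 1 + 0 = X 1
      rw [add_zero]
  rw [h, subst_self]
  rfl

/-- `T_{-b}` undoes `T_b` for `b` in `x` only. [folklore] -/
theorem shear_neg_shear {b : MvPowerSeries (Fin 2) k}
    (hb : ∀ e : Fin 2 →₀ ℕ, e 1 ≠ 0 → coeff e b = 0) (hb0 : constantCoeff b = 0)
    (g : MvPowerSeries (Fin 2) k) : subst ![X 0, X 1 + -b] (subst ![X 0, X 1 + b] g) = g := by
  rw [shear_shear hb (by rw [map_neg, hb0, neg_zero]) hb0, neg_add_cancel, shear_zero]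

/-- A shear by a series in `x` only does not change the `y`-linear coefficient. [folklore] -/
theorem coeff_single_one_shear {ψ : MvPowerSeries (Fin 2) k}
    (hψ : ∀ e : Fin 2 →₀ ℕ, e 1 ≠ 0 → coeff e ψ = 0) (hψ0 : constantCoeff ψ = 0)
    (L : MvPowerSeries (Fin 2) k) :
    coeff (Finsupp.single 1 1) (subst ![X 0, X 1 + ψ] L) = coeff (Finsupp.single 1 1) L := by
  classical
  rw [CobordantArc.coeff_degree_one_subst ![X 0, X 1 + ψ] (constantCoeff_shear hψ0) L _
    (Finsupp.degree_single _ _), Fin.sum_univ_two, Matrix.cons_val_zero, shearFamily_apply_one,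
    map_add, coeff_index_single_X, coeff_index_single_self_X, coeff_single_one_of_noY hψ]
  simp

/-- Killing `y` after a shear by `ψ` (in `x` only) is the substitution `(x, ψ)`. [folklore] -/
theorem kill_shear {a : Fin 2 → MvPowerSeries (Fin 2) k} (ha0 : a 0 = X 0) (ha1 : a 1 = 0)
    {ψ : MvPowerSeries (Fin 2) k} (hψ : ∀ e : Fin 2 →₀ ℕ, e 1 ≠ 0 → coeff e ψ = 0)
    (hψ0 : constantCoeff ψ = 0) (g : MvPowerSeries (Fin 2) k) :
    subst a (subst ![X 0, X 1 + ψ] g) = subst ![X 0, ψ] g := by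
  have ha : HasSubst a := hasSubst_of_constantCoeff_zero (constantCoeff_kill ha0 ha1)
  rw [subst_comp_subst_apply (hasSubst_shear hψ0) ha]
  congr 1
  funext s
  fin_cases s
  · show subst a (X 0) = X 0
    rw [subst_X ha, ha0]
  · show subst a (X 1 + ψ) = ψ
    rw [subst_add ha, subst_X ha, ha1, subst_eq_self_of_noY ha ha0 hψ, zero_add]

/-! ### 4. Graph form of a `y`-regular smooth germ -/

/-- The `y`-coefficient of `y · W` at `y¹` is `W(0)`. [folklore] -/
theorem coeff_single_one_X_mul (W : MvPowerSeries (Fin 2) k) :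
    coeff (Finsupp.single 1 1) (X 1 * W) = constantCoeff W := by
  classical
  rw [X_def, coeff_monomial_mul, if_pos le_rfl, one_mul, tsub_self,
    coeff_zero_eq_constantCoeff_apply]

/-- GRAPH FORM (order-one formal implicit function theorem): if `L(0) = 0` and `∂L/∂y(0) ≠ 0`
then for some `ψ` without `y`-monomials and with `ψ(0) = 0`, the shear `y ↦ y + ψ` carries `L`
to `y · W` with `W(0) ≠ 0` (so `L = unit · (y - ψ(x))`). [folklore] -/
theorem graph (L : MvPowerSeries (Fin 2) k) (hL0 : constantCoeff L = 0)
    (hL1 : coeff (Finsupp.single 1 1) L ≠ 0) :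
    ∃ ψ W : MvPowerSeries (Fin 2) k, (∀ e : Fin 2 →₀ ℕ, e 1 ≠ 0 → coeff e ψ = 0) ∧
      constantCoeff ψ = 0 ∧ constantCoeff W ≠ 0 ∧ subst ![X 0, X 1 + ψ] L = X 1 * W := by
  classical
  -- the kill-`y` family `κ = (x, 0)`
  obtain ⟨κ, hκ0, hκ1⟩ : ∃ a : Fin 2 → MvPowerSeries (Fin 2) k, a 0 = X 0 ∧ a 1 = 0 :=
    ⟨![X 0, 0], rfl, rfl⟩
  have hκc := constantCoeff_kill hκ0 hκ1
  have hκs : HasSubst κ := hasSubst_of_constantCoeff_zero hκc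
  -- the formal coordinate change `Θ = (x, L)` and its inverse `Ξ = (x, η)`
  set Θ : Fin 2 → MvPowerSeries (Fin 2) k := ![X 0, L] with hΘ
  have hΘ0 : ∀ i, constantCoeff (Θ i) = 0 := by
    intro i
    fin_cases i
    · exact constantCoeff_X 0
    · exact hL0
  have hdet : IsUnit (FormalCoordChange.linMat Θ).det := by
    rw [Matrix.det_fin_two]
    simp only [FormalCoordChange.linMat, Matrix.of_apply, hΘ, Matrix.cons_val_zero,
      Matrix.cons_val_one, coeff_index_single_X]
    simpa using hL1
  obtain ⟨Ξ, hΞ0, hΞΘ, -⟩ := FormalCoordChange.exists_comp_inverse hΘ0 hdet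
  have hΞs : HasSubst Ξ := hasSubst_of_constantCoeff_zero hΞ0
  have hΞ_0 : Ξ 0 = X 0 := by
    have h := hΞΘ 0
    rwa [show Θ 0 = X 0 from rfl, subst_X hΞs] at h
  have hΞL : subst Ξ L = X 1 := hΞΘ 1
  -- `ψ := η(x, 0)` satisfies `L(x, ψ) = 0`
  set ψ : MvPowerSeries (Fin 2) k := subst κ (Ξ 1) with hψdef
  have hψX : ∀ e : Fin 2 →₀ ℕ, e 1 ≠ 0 → coeff e ψ = 0 := noY_kill hκ0 hκ1 _
  have hψ0 : constantCoeff ψ = 0 := by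
    rw [hψdef, constantCoeff_subst_eq_of_constantCoeff_eq_zero _ hκc]
    exact hΞ0 1
  have hLψ : subst ![X 0, ψ] L = 0 := by
    have h1 : subst κ (subst Ξ L) = 0 := by rw [hΞL, subst_X hκs, hκ1]
    rw [subst_comp_subst_apply hΞs hκs] at h1
    convert h1 using 2
    funext s
    fin_cases s
    · show X 0 = subst κ (Ξ 0)
      rw [hΞ_0, subst_X hκs, hκ0]
    · rfl
  -- Taylor shift: `M := T_ψ L` is killed by `y ↦ 0`, hence divisible by `y`
  set M : MvPowerSeries (Fin 2) k := subst ![X 0, X 1 + ψ] L with hM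
  have hKM : subst κ M = 0 := by rw [hM, kill_shear hκ0 hκ1 hψX hψ0, hLψ]
  obtain ⟨W, hW⟩ := X_dvd_of_kill_eq_zero hκ0 hκ1 hKM
  refine ⟨ψ, W, hψX, hψ0, ?_, hW⟩
  rw [← coeff_single_one_X_mul W, ← hW, hM, coeff_single_one_shear hψX hψ0 L]
  exact hL1

/-! ### 5. Orders -/

/-- `n ≤ ord a`, `n ≤ ord b` ⟹ `n ≤ ord (a - b)`. [folklore] -/
theorem le_order_sub {n : ℕ∞} {a b : MvPowerSeries (Fin 2) k} (ha : n ≤ a.order)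
    (hb : n ≤ b.order) : n ≤ (a - b).order := by
  rw [sub_eq_add_neg]
  exact le_trans (le_min ha (by rwa [order_neg])) min_order_le_add

/-- `ord (g ^ n) = n · ord g` (`k` is a field). [folklore] -/
theorem order_pow_eq (g : MvPowerSeries (Fin 2) k) (n : ℕ) : (g ^ n).order = n * g.order := by
  induction n with
  | zero =>
    rw [pow_zero, Nat.cast_zero, zero_mul]
    exact weightedOrder_one _
  | succ n ih => rw [pow_succ, order_mul, ih, Nat.cast_succ, add_mul, one_mul]

/-- From `ord δ^d ≥ N`: the coefficients of `δ` at exponents `e` with `d · |e| < N` vanish.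
[folklore] -/
theorem coeff_eq_zero_of_le_order_pow {d N : ℕ} {δ : MvPowerSeries (Fin 2) k}
    (h : (N : ℕ∞) ≤ (δ ^ d).order) (e : Fin 2 →₀ ℕ) (he : d * e.degree < N) :
    coeff e δ = 0 := by
  by_contra hne
  have h1 : δ.order ≤ e.degree := order_le hne
  have h2 : (N : ℕ∞) ≤ (d : ℕ∞) * (e.degree : ℕ∞) := by
    rw [order_pow_eq] at h
    exact h.trans (by gcongr)
  have h3 : N ≤ d * e.degree := by exact_mod_cast h2
  omega

end Literature.AlgebraicGeometry.Resolution.FormalShear
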